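import Summits.Parity.BatemanHorn.Theorems.SoloInformedPrimePowerCensus
import Summits.Parity.BatemanHorn.Theorems.SoloInformedMidPowerValues

/-!
# SoloInformedQuinticPrimeCount — the `π`-level localisation for every Bateman–Horn polynomial of degree `≤ 5`

Solo unit `solo-Parity-informed` (ideation tier, informed mode), session 15; `PLAN.md` §23, CLAIMS C66.

THE PROPER-PRIME-POWER HYPOTHESIS REDUCED TO SMALL EXPONENTS.  For `g ∈ ℤ[X]` with `IsBatemanHornSystem ![g]`
and `deg g = d ≥ 2`, the term `PP_g(x) = ∑_{1 ≤ n ≤ x, |g(n)| not prime} Λ(|g(n)|)` is `o(x)` as soon as, for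
every exponent `k` with `3 ≤ k ≤ d/2`, the `n ≤ x` with `g(n) = p^k` (`p` prime) are `o(x / log x)`
(`properPrimePow_sum_isLittleO_of_smallPrimePowers`): the exponent `k = 2` is the one-non-residue local
sieve `SoloInformedPrimeSquareValues`, the exponents `d/2 < k < d` are the convexity count
`SoloInformedMidPowerValues`, `k = d` is the Liouville spacing count `SoloInformedPowerValuesCount`, and
`k > d` is the trivial census `SoloInformedPrimePowerCensus`.  For `d ≤ 5` the hypothesis is EMPTY, so
unconditionally, from Mathlib-level inputs only:

* `properPrimePow_sum_isLittleO_of_natDegree_le_five`: `PP_g(x) = o(x)` for every Bateman–Horn polynomial of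
  degree `2 ≤ d ≤ 5` (e.g. `n⁴ + 2`: cubes among its values were the first case not covered before);
* `batemanHornAsymptotic_iff_isEquivalent_psi_of_natDegree_le_five`:  `BH(g) ⟺ ψ_g(x) ~ C(g) x`;
* `batemanHornAsymptotic_iff_largeDivisorSum_isLittleO_of_natDegree_le_five` (every admissible cut) and
  `batemanHornAsymptotic_iff_largeDivisorSum_isLittleO_rpowCut_of_natDegree_le_five` (`y = x^{1-ε}`):
    `BH(g) ⟺ T_g(x; y) = ∑_{n ≤ x} ∑_{e ∣ |g(n)|, e > y} μ(e) log e = o(x)`.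

The first exponents left open in general are `(d, k) = (6, 3), (7, 3)` (prime cubes among sextic / septic
values).  No bearing on the truth of the conjecture.
-/

namespace Summit.Parity.BatemanHorn.Theorems

open Finset Filter ArithmeticFunction Asymptotics Polynomial
open scoped ArithmeticFunction.Moebius Topology Classical
open Literature.NumberTheory.Sieve (IsBatemanHornSystem batemanHornConst BatemanHornAsymptotic)

/-! ### `PP_g = o(x)` from the small exponents -/

/-- **Proper prime powers are negligible once the prime `k`-th powers with `3 ≤ k ≤ d/2` are:** for a
Bateman–Horn polynomial `g` of degree `d ≥ 2`, if for every `3 ≤ k ≤ d/2` and every `δ > 0` eventually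
`#{1 ≤ n ≤ x : g(n) = p^k, p prime} · log x ≤ δ x`, then `∑_{1 ≤ n ≤ x, |g(n)| not prime} Λ(|g(n)|) = o(x)`. -/
theorem properPrimePow_sum_isLittleO_of_smallPrimePowers {g : ℤ[X]} (hg : IsBatemanHornSystem ![g])
    (hdeg : 2 ≤ g.natDegree)
    (hsmall : ∀ k : ℕ, 3 ≤ k → 2 * k ≤ g.natDegree → ∀ δ : ℝ, 0 < δ → ∀ᶠ x : ℕ in atTop,
      (#((Icc 1 x).filter fun n : ℕ => ∃ p : ℕ, p.Prime ∧ g.eval (n : ℤ) = (p : ℤ) ^ k) : ℝ)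
        * Real.log x ≤ δ * x) :
    (fun x : ℕ => ∑ n ∈ (Icc 1 x).filter (fun n : ℕ => ¬Nat.Prime (g.eval (n : ℤ)).natAbs),
        Λ (g.eval (n : ℤ)).natAbs) =o[atTop] fun x : ℕ => (x : ℝ) := by
  have hirr : Irreducible g := by simpa using hg.irreducible 0
  have hlc : 0 < g.leadingCoeff := by simpa using hg.leadingCoeff_pos 0
  obtain ⟨d, hd⟩ : ∃ d : ℕ, g.natDegree = d := ⟨_, rfl⟩
  have hdeg0 : 0 < g.natDegree := by omega
  have hd0 : 0 < d := by omega
  have hd2 : 2 ≤ d := by omega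
  have hd0R : (0 : ℝ) < d := by exact_mod_cast hd0
  obtain ⟨n₀, hn₀⟩ := exists_eval_natCast_pos hdeg0 hlc
  obtain ⟨B, hB⟩ := exists_abs_log_natAbs_eval_sub_le hdeg0
  have hB0 : 0 ≤ B := (abs_nonneg _).trans (hB 1 le_rfl)
  rw [isLittleO_iff]
  intro δ hδ
  -- every exponent `2 ≤ k ≤ d` contributes `≤ δ' x / log x`, `δ' = δ / (4 (d + 1) d)`
  set δ' : ℝ := δ / (4 * ((d : ℝ) + 1) * d) with hδ'
  have hδ'0 : 0 < δ' := by positivity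
  have hk_each : ∀ k ∈ Icc 2 d, ∀ᶠ x : ℕ in atTop,
      (#((Icc 1 x).filter fun n : ℕ => ∃ p : ℕ, p.Prime ∧ g.eval (n : ℤ) = (p : ℤ) ^ k) : ℝ)
        * Real.log x ≤ δ' * x := by
    intro k hk
    obtain ⟨hk2, hkd⟩ := mem_Icc.mp hk
    rcases hk2.eq_or_lt with rfl | hk3
    · exact eventually_card_primeSq_mul_log_le hg hdeg hδ'0
    by_cases h2k : 2 * k ≤ d
    · exact hsmall k (by omega) (by omega) δ' hδ'0
    -- `d < 2k`: compare with ALL `k`-th power values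
    have hmono : ∀ x : ℕ,
        (#((Icc 1 x).filter fun n : ℕ => ∃ p : ℕ, p.Prime ∧ g.eval (n : ℤ) = (p : ℤ) ^ k) : ℝ)
          ≤ #((Icc 1 x).filter fun n : ℕ => ∃ m : ℕ, (g.eval (n : ℤ)).natAbs = m ^ k) := by
      intro x
      have hsub : ((Icc 1 x).filter fun n : ℕ => ∃ p : ℕ, p.Prime ∧ g.eval (n : ℤ) = (p : ℤ) ^ k)
          ⊆ (Icc 1 x).filter fun n : ℕ => ∃ m : ℕ, (g.eval (n : ℤ)).natAbs = m ^ k := by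
        intro n hn
        obtain ⟨hnI, p, -, hp⟩ := mem_filter.mp hn
        refine mem_filter.mpr ⟨hnI, p, ?_⟩
        rw [hp, Int.natAbs_pow]
        simp
      exact_mod_cast card_le_card hsub
    rcases Nat.lt_or_ge k d with hkd' | hkd'
    · have h := eventually_card_midPowValues_mul_log_le (g := g) (k := k) (by omega) (by omega) hlc hδ'0
      filter_upwards [h, eventually_ge_atTop 1] with x hx hx1
      exact (mul_le_mul_of_nonneg_right (hmono x) (Real.log_nonneg (by exact_mod_cast hx1))).trans hx
    · have hkd'' : k = d := le_antisymm hkd hkd'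
      have h := eventually_card_powValues_mul_log_le hirr hdeg hlc hδ'0
      rw [hd, ← hkd''] at h
      filter_upwards [h, eventually_ge_atTop 1] with x hx hx1
      exact (mul_le_mul_of_nonneg_right (hmono x) (Real.log_nonneg (by exact_mod_cast hx1))).trans hx
  have h1 := (Filter.eventually_all_finset (Icc 2 d)).mpr hk_each
  have h3 := eventually_higherPow_count_mul_log_le_natDegree hd0 hB0 (show 0 < δ / 4 by positivity)
  have h4 : ∀ᶠ x : ℕ in atTop, ((d : ℝ) + 1) * Real.log x * n₀ ≤ δ / 4 * x := by
    have hlo := (Real.isLittleO_log_id_atTop.comp_tendsto tendsto_natCast_atTop_atTop).def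
      (show 0 < δ / (4 * ((d : ℝ) + 1) * (n₀ + 1)) by positivity)
    filter_upwards [hlo, eventually_ge_atTop 1] with x hx hx1
    simp only [Function.comp_apply, id_eq, Real.norm_eq_abs] at hx
    rw [abs_of_nonneg (Real.log_nonneg (by exact_mod_cast hx1)), abs_of_nonneg (Nat.cast_nonneg x)] at hx
    have hn : (n₀ : ℝ) ≤ n₀ + 1 := by linarith
    calc ((d : ℝ) + 1) * Real.log x * n₀
        ≤ ((d : ℝ) + 1) * (δ / (4 * ((d : ℝ) + 1) * (n₀ + 1)) * x) * (n₀ + 1) := by gcongr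
      _ = δ / 4 * x := by field_simp
  have hlog : Tendsto (fun x : ℕ => Real.log x) atTop atTop :=
    Real.tendsto_log_atTop.comp tendsto_natCast_atTop_atTop
  filter_upwards [h1, h3, h4, hlog.eventually (eventually_ge_atTop B), eventually_ge_atTop 1]
    with x hx1 hx3 hx4 hBL hx
  have hL0 : 0 ≤ Real.log x := Real.log_nonneg (by exact_mod_cast hx)
  have hPP0 : 0 ≤ ∑ n ∈ (Icc 1 x).filter (fun n : ℕ => ¬Nat.Prime (g.eval (n : ℤ)).natAbs),
      Λ (g.eval (n : ℤ)).natAbs := sum_nonneg fun n _ => vonMangoldt_nonneg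
  rw [Real.norm_eq_abs, Real.norm_eq_abs, abs_of_nonneg hPP0, abs_of_nonneg (Nat.cast_nonneg x)]
  have hmain := properPrimePow_polyVal_sum_le_natDegree g hd hd0 hn₀ hB hx
  have hhi := card_biUnion_natAbs_eval_eq_pow_le g hdeg0 (Icc 1 x)
    ⌊(Real.exp B * (x : ℝ) ^ d) ^ ((d + 1 : ℕ) : ℝ)⁻¹⌋₊ ⌊Real.log (Real.exp B * (x : ℝ) ^ d) / Real.log 2⌋₊
  rw [hd] at hhi
  have hhi' : (#((range (⌊(Real.exp B * (x : ℝ) ^ d) ^ ((d + 1 : ℕ) : ℝ)⁻¹⌋₊ + 1)).biUnion fun m : ℕ =>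
      (range (⌊Real.log (Real.exp B * (x : ℝ) ^ d) / Real.log 2⌋₊ + 1)).biUnion fun k : ℕ =>
        (Icc 1 x).filter fun n : ℕ => (g.eval (n : ℤ)).natAbs = m ^ k) : ℝ)
      ≤ (((⌊(Real.exp B * (x : ℝ) ^ d) ^ ((d + 1 : ℕ) : ℝ)⁻¹⌋₊ + 1)
        * (⌊Real.log (Real.exp B * (x : ℝ) ^ d) / Real.log 2⌋₊ + 1) * (2 * d) : ℕ) : ℝ) := by
    exact_mod_cast hhi
  have hdL : (d : ℝ) * Real.log x + B ≤ ((d : ℝ) + 1) * Real.log x := by linarith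
  -- the middle block: `∑_k #PK_k · log x ≤ #Icc 2 d · δ' x ≤ d δ' x`
  have hmid : (∑ k ∈ Icc 2 d,
      (#((Icc 1 x).filter fun n : ℕ => ∃ p : ℕ, p.Prime ∧ g.eval (n : ℤ) = (p : ℤ) ^ k) : ℝ)) * Real.log x
        ≤ d * (δ' * x) := by
    rw [Finset.sum_mul]
    refine (sum_le_sum fun k hk => hx1 k hk).trans ?_
    rw [sum_const, nsmul_eq_mul, Nat.card_Icc]
    have hc : ((d + 1 - 2 : ℕ) : ℝ) ≤ d := by exact_mod_cast (by omega : d + 1 - 2 ≤ d)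
    exact mul_le_mul_of_nonneg_right hc (by positivity)
  have hmid' : ((d : ℝ) + 1) * (d * (δ' * x)) = δ / 4 * x := by
    rw [hδ']
    field_simp
  calc ∑ n ∈ (Icc 1 x).filter (fun n : ℕ => ¬Nat.Prime (g.eval (n : ℤ)).natAbs), Λ (g.eval (n : ℤ)).natAbs
      ≤ (((d : ℝ) + 1) * Real.log x) * (n₀
          + ∑ k ∈ Icc 2 d,
              (#((Icc 1 x).filter fun n : ℕ => ∃ p : ℕ, p.Prime ∧ g.eval (n : ℤ) = (p : ℤ) ^ k) : ℝ)
          + (((⌊(Real.exp B * (x : ℝ) ^ d) ^ ((d + 1 : ℕ) : ℝ)⁻¹⌋₊ + 1)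
            * (⌊Real.log (Real.exp B * (x : ℝ) ^ d) / Real.log 2⌋₊ + 1) * (2 * d) : ℕ) : ℝ)) := by
        refine hmain.trans ?_
        have h4L : 0 ≤ ((d : ℝ) + 1) * Real.log x := by positivity
        gcongr
    _ = ((d : ℝ) + 1) * Real.log x * n₀
          + ((d : ℝ) + 1) * ((∑ k ∈ Icc 2 d,
              (#((Icc 1 x).filter fun n : ℕ => ∃ p : ℕ, p.Prime ∧ g.eval (n : ℤ) = (p : ℤ) ^ k) : ℝ))
                * Real.log x)
          + ((d : ℝ) + 1) * Real.log x * (((⌊(Real.exp B * (x : ℝ) ^ d) ^ ((d + 1 : ℕ) : ℝ)⁻¹⌋₊ + 1)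
            * (⌊Real.log (Real.exp B * (x : ℝ) ^ d) / Real.log 2⌋₊ + 1) * (2 * d) : ℕ) : ℝ) := by ring
    _ ≤ δ / 4 * x + ((d : ℝ) + 1) * (d * (δ' * x)) + δ / 4 * x :=
        add_le_add (add_le_add hx4 (mul_le_mul_of_nonneg_left hmid (by positivity))) hx3
    _ ≤ δ * x := by
        rw [hmid']
        have hx0 : (0 : ℝ) ≤ x := Nat.cast_nonneg x
        nlinarith

/-- **Proper prime powers among the values of a Bateman–Horn polynomial of degree `2 ≤ d ≤ 5` are
negligible:** `∑_{1 ≤ n ≤ x, |g(n)| not prime} Λ(|g(n)|) = o(x)` — unconditionally (for `d ≤ 5` there is no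
exponent `3 ≤ k ≤ d/2`). -/
theorem properPrimePow_sum_isLittleO_of_natDegree_le_five {g : ℤ[X]} (hg : IsBatemanHornSystem ![g])
    (hdeg : 2 ≤ g.natDegree) (hdeg5 : g.natDegree ≤ 5) :
    (fun x : ℕ => ∑ n ∈ (Icc 1 x).filter (fun n : ℕ => ¬Nat.Prime (g.eval (n : ℤ)).natAbs),
        Λ (g.eval (n : ℤ)).natAbs) =o[atTop] fun x : ℕ => (x : ℝ) :=
  properPrimePow_sum_isLittleO_of_smallPrimePowers hg hdeg fun k hk3 hk _ _ => by omega

/-! ### The localisation for polynomials of degree `≤ 5` -/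

/-- **`BatemanHornAsymptotic ![g] ⟺ ∑_{n ≤ x} Λ(|g(n)|) ~ C(g) x`** for every Bateman–Horn polynomial of degree
`2 ≤ d ≤ 5`. -/
theorem batemanHornAsymptotic_iff_isEquivalent_psi_of_natDegree_le_five {g : ℤ[X]}
    (hg : IsBatemanHornSystem ![g]) (hdeg : 2 ≤ g.natDegree) (hdeg5 : g.natDegree ≤ 5) :
    BatemanHornAsymptotic ![g] ↔
      ((fun x : ℕ => ∑ n ∈ Icc 1 x, Λ (g.eval (n : ℤ)).natAbs) ~[atTop]
        fun x : ℕ => batemanHornConst ![g] * (x : ℝ)) :=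
  batemanHornAsymptotic_iff_isEquivalent_psi_of_properPrimePow hg
    (properPrimePow_sum_isLittleO_of_natDegree_le_five hg hdeg hdeg5)

/-- **`BatemanHornAsymptotic ![g] ⟺ T_g(x; y) = o(x)`** for every Bateman–Horn polynomial of degree `2 ≤ d ≤ 5`
and every admissible cut `y → ∞`, `y log y = o(x)`. -/
theorem batemanHornAsymptotic_iff_largeDivisorSum_isLittleO_of_natDegree_le_five {g : ℤ[X]}
    (hg : IsBatemanHornSystem ![g]) (hdeg : 2 ≤ g.natDegree) (hdeg5 : g.natDegree ≤ 5)
    {y : ℕ → ℕ} (hy : Tendsto y atTop atTop)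
    (hy' : (fun x : ℕ => Real.log (y x) * (y x : ℝ)) =o[atTop] fun x : ℕ => (x : ℝ)) :
    BatemanHornAsymptotic ![g] ↔
      (fun x : ℕ => ∑ n ∈ Icc 1 x,
          ∑ e ∈ ((g.eval (n : ℤ)).natAbs).divisors with y x < (g.eval (n : ℤ)).natAbs / e,
            (μ ((g.eval (n : ℤ)).natAbs / e) : ℝ) * Real.log ((((g.eval (n : ℤ)).natAbs / e : ℕ)) : ℝ))
        =o[atTop] fun x : ℕ => (x : ℝ) :=
  batemanHornAsymptotic_iff_largeDivisorSum_isLittleO_of_properPrimePow hg hdeg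
    (properPrimePow_sum_isLittleO_of_natDegree_le_five hg hdeg hdeg5) hy hy'

/-- **`BatemanHornAsymptotic ![g] ⟺ T_g(x; x^{1-ε}) = o(x)`** (`0 < ε < 1`) for every Bateman–Horn polynomial
`g` of degree `2 ≤ d ≤ 5`: the conjunct's instance for `g` is exactly the cancellation of `μ · log` over the
divisors `e > x^{1-ε}` of the values `|g(n)| ≍ x^d`. -/
theorem batemanHornAsymptotic_iff_largeDivisorSum_isLittleO_rpowCut_of_natDegree_le_five {g : ℤ[X]}
    (hg : IsBatemanHornSystem ![g]) (hdeg : 2 ≤ g.natDegree) (hdeg5 : g.natDegree ≤ 5)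
    {ε : ℝ} (hε : 0 < ε) (hε1 : ε < 1) :
    BatemanHornAsymptotic ![g] ↔
      (fun x : ℕ => ∑ n ∈ Icc 1 x,
          ∑ e ∈ ((g.eval (n : ℤ)).natAbs).divisors with
              ⌊(x : ℝ) ^ (1 - ε)⌋₊ < (g.eval (n : ℤ)).natAbs / e,
            (μ ((g.eval (n : ℤ)).natAbs / e) : ℝ) * Real.log ((((g.eval (n : ℤ)).natAbs / e : ℕ)) : ℝ))
        =o[atTop] fun x : ℕ => (x : ℝ) :=
  batemanHornAsymptotic_iff_largeDivisorSum_isLittleO_rpowCut_of_properPrimePow hg hdeg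
    (properPrimePow_sum_isLittleO_of_natDegree_le_five hg hdeg hdeg5) hε hε1

/-- The same localisation under the small-exponent hypothesis, for every degree `d ≥ 2`:
`BH(g) ⟺ ψ_g ~ C(g) x` provided the prime `k`-th powers with `3 ≤ k ≤ d/2` among the values are `o(x/log x)`. -/
theorem batemanHornAsymptotic_iff_isEquivalent_psi_of_smallPrimePowers {g : ℤ[X]}
    (hg : IsBatemanHornSystem ![g]) (hdeg : 2 ≤ g.natDegree)
    (hsmall : ∀ k : ℕ, 3 ≤ k → 2 * k ≤ g.natDegree → ∀ δ : ℝ, 0 < δ → ∀ᶠ x : ℕ in atTop,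
      (#((Icc 1 x).filter fun n : ℕ => ∃ p : ℕ, p.Prime ∧ g.eval (n : ℤ) = (p : ℤ) ^ k) : ℝ)
        * Real.log x ≤ δ * x) :
    BatemanHornAsymptotic ![g] ↔
      ((fun x : ℕ => ∑ n ∈ Icc 1 x, Λ (g.eval (n : ℤ)).natAbs) ~[atTop]
        fun x : ℕ => batemanHornConst ![g] * (x : ℝ)) :=
  batemanHornAsymptotic_iff_isEquivalent_psi_of_properPrimePow hg
    (properPrimePow_sum_isLittleO_of_smallPrimePowers hg hdeg hsmall)

end Summit.Parity.BatemanHorn.Theorems
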